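import Summits.CriticalPhenomena.CardyFormulaZ2.Theorems.CardyAnchoredRigidityCardyShadowIsolatedDilationDynamicsGlue
import Summits.CriticalPhenomena.CardyFormulaZ2.Theorems.CardySelfRefinementScaleInvariantLimitsStubLagsOfScaleInvariantLimits
import Summits.CriticalPhenomena.CardyFormulaZ2.Theorems.CardySelfRefinementScaleInvariantLimitsOfEngine
import Summits.CriticalPhenomena.CardyFormulaZ2.Theorems.CardySelfRefinementCriticalPathRSW
import Summits.CriticalPhenomena.CardyFormulaZ2.Theorems.CardySelfRefinementRussoDrift
import Literature.Probability.Percolation.QuadCrossingContinuityEventsDischarge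
import Literature.Probability.Percolation.QuadCrossingRotationInvarianceOfThm21
import Literature.Probability.Percolation.QuadCrossingRotationInvarianceOfSS
import Literature.Probability.Percolation.QuadCrossingNoiseDiscrete
import Literature.Probability.Percolation.QuadCrossingRawClosed
import HarnessLib

/-!
# Crux `CardyShadowIsolated` (stmt-CriticalPhenomena-5767): stub S1 `stub_latticeTwoLags`
# from `ScaleInvariantLimits` and the rectangle ↔ quad dictionary

Stub S1 of the lead's skeleton (line `dilation-dynamics` v4) is the *lattice* statement

    ∀ R, P_{δ/2}(R) − P_δ(R) → 0  and  P_{δ/3}(R) − P_δ(R) → 0   (δ → 0⁺),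

`P_δ(R) = bondDomainCrossingProb R δ` (G02 / Smirnov rendering: open crossing of the discrete
domain `Ω_δ = meshDomain Ω δ` between the DISCRETE arcs `discreteArc Ω δ (R.arc 0)`,
`discreteArc Ω δ (R.arc 2)`).  It is the conformal-rectangle shadow of the target
`ScaleInvariantLimits` (stmt-CriticalPhenomena-10265, route CardySelfRefinement: every
subsequential Schramm–Smirnov quad-crossing limit of bond-`ℤ²` is dilation invariant).  This file
makes that shadow relation a tree theorem and isolates EXACTLY what separates the two:

* **`ScaleInvariantLimits` ⇒ S1 for the Schramm–Smirnov / DKKMO rendering, unconditionally.**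
  For every conformal rectangle `R` and every `k > 1`,
  `quadCrossingProb (δ/k) R − quadCrossingProb δ R → 0`
  (`quadCrossingProb_lag_of_scaleInvariantLimits`), where `quadCrossingProb δ R` is DKKMO's
  probability that some open path drawn in `closure Ω ∩ openEdgeUnion δ ω` joins the CONTINUUM arcs
  `R.arc 0`, `R.arc 2`.  Ingredients, all proved in the tree: `X` ⇒ lag merging of the laws
  `squareCrossingLaw univ` on joint crossing events (`stub_lags_of_scaleInvariantLimits`, which
  needs Schramm–Smirnov's Lemma 5.1 — DISCHARGED, `SchrammSmirnov2011_lemma_5_1_holds`); the mesh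
  renormalisation `squareCrossingLaw D δ = z2QuadLaw D (δ√2)`; and the EXACT identity
  `quadCrossingProb δ R = μ_δ(⊞_Q)` for a square-model quad `Q` of `R`
  (`quadCrossingProb_eq_measureReal_z2QuadLaw`: `quadCrossing_eq_setOf_exists_isCrossing`,
  `mem_z2QuadConfig_iff_exists_isCrossing`, `z2QuadLaw_apply`).
* **The dictionary.**  S1 for `R` follows as soon as the two renderings of the crossing
  probability of `R` merge, `bondDomainCrossingProb R δ − quadCrossingProb δ R → 0`
  (`latticeTwoLags_of_scaleInvariantLimits_of_dictionary`, pointwise in `R`; the registered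
  global form is `stub_latticeTwoLags_of_scaleInvariantLimits`).  This merging is the boundary-RSW
  statement flagged OPEN in `Literature/Probability/Percolation/QuadCrossingSpaceZ2.lean` (module
  docstring: "whose asymptotic agreement with the continuum-crossing event `⊞_Q` is a boundary
  RSW statement, not a definition") and in `QuadCrossingRotationInvariance.lean` ("the transfer to
  the discrete-arc events `discreteCrossing` … is left to consumers"); it enters VERBATIM as a
  hypothesis, no `Prop` handle is introduced.  Under it the two renderings have the same lags
  (`latticeLag_iff_of_dictionary`).
* **The engine form.**  With `scaleInvariantLimits_of_engine` and the proved items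
  `CriticalPathRSW_proof`, `russoDrift_proof`:  `TrivialSectorRate` (stmt-10266) →
  `GradientComparability` (stmt-10269) → dictionary → S1
  (`latticeTwoLags_of_engine_of_dictionary`).

So S1 ⟸ (X ∧ Dict) ⟸ (10266 ∧ 10269 ∧ Dict), next to the landed S1 ⟸ `LimitExists`
(`…LimitExistsBridge`).  Nothing here proves S1: `X` and the dictionary are open.

References: V. Beffara, *Is critical 2D percolation universal?*, Progr. Probab. 60 (2008),
arXiv:0708.3908, §5; O. Schramm, S. Smirnov, Ann. Probab. 39 (2011), arXiv:1101.5820, §1.3,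
Lemma 5.1, Cor. 5.2; H. Duminil-Copin, K. K. Kozlowski, D. Krachun, I. Manolescu, M. Oulamara,
arXiv:2012.11672v1, §1.2 (the event `𝒞_δ(Q)`); S. Smirnov, C. R. Acad. Sci. 333 (2001), §2
(discrete arcs).
-/

noncomputable section

namespace Summit.CriticalPhenomena.CardyFormulaZ2.Theorems.CardyShadowIsolated.LatticeTwoLags

open Set Filter Topology MeasureTheory
open Literature.Probability.RandomPlanarGeometry Literature.Probability.Percolation
open Literature.Probability.Percolation.QuadCrossing Literature.Probability.LatticeModels
open Summit.CriticalPhenomena.CardyFormulaZ2.Theses.CardySelfRefinement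
open Summit.CriticalPhenomena.CardyFormulaZ2.Theorems

/-! ### Real-variable bookkeeping on the filter `𝓝[>] 0` -/

/-- Undoing a mesh renormalisation `η ↦ η c` (`c > 0`) in a lag statement: if
`φ (k η c) − φ (η c) → 0` as `η → 0⁺` then `φ (k δ) − φ δ → 0` as `δ → 0⁺`. [folklore] -/
theorem tendsto_lag_of_rescale {φ : ℝ → ℝ} {c k : ℝ} (hc : 0 < c)
    (h : Tendsto (fun η : ℝ => φ (k * η * c) - φ (η * c)) (𝓝[>] (0 : ℝ)) (𝓝 0)) :
    Tendsto (fun δ : ℝ => φ (k * δ) - φ δ) (𝓝[>] (0 : ℝ)) (𝓝 0) := by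
  have hdiv : Tendsto (fun δ : ℝ => δ / c) (𝓝[>] (0 : ℝ)) (𝓝[>] (0 : ℝ)) := by
    refine tendsto_nhdsWithin_of_tendsto_nhds_of_eventually_within _ ?_ ?_
    · have h0 : Tendsto (fun δ : ℝ => δ / c) (𝓝 0) (𝓝 (0 / c)) := tendsto_id.div_const c
      rw [zero_div] at h0
      exact h0.mono_left nhdsWithin_le_nhds
    · filter_upwards [self_mem_nhdsWithin] with δ hδ
      exact div_pos (mem_Ioi.1 hδ) hc
  have h1 := h.comp hdiv
  refine h1.congr' (Eventually.of_forall fun δ => ?_)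
  show φ (k * (δ / c) * c) - φ (δ / c * c) = φ (k * δ) - φ δ
  rw [mul_assoc, div_mul_cancel₀ _ hc.ne']

/-- From the lag `k` read upwards (`φ (k η) − φ η → 0`) to the lag read downwards
(`φ (δ / k) − φ δ → 0`), `k > 0`: substitute `η = δ / k` and change sign. [folklore] -/
theorem tendsto_lag_div_of_tendsto_lag_mul {φ : ℝ → ℝ} {k : ℝ} (hk : 0 < k)
    (h : Tendsto (fun η : ℝ => φ (k * η) - φ η) (𝓝[>] (0 : ℝ)) (𝓝 0)) :
    Tendsto (fun δ : ℝ => φ (δ / k) - φ δ) (𝓝[>] (0 : ℝ)) (𝓝 0) := by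
  have hdiv : Tendsto (fun δ : ℝ => δ / k) (𝓝[>] (0 : ℝ)) (𝓝[>] (0 : ℝ)) := by
    refine tendsto_nhdsWithin_of_tendsto_nhds_of_eventually_within _ ?_ ?_
    · have h0 : Tendsto (fun δ : ℝ => δ / k) (𝓝 0) (𝓝 (0 / k)) := tendsto_id.div_const k
      rw [zero_div] at h0
      exact h0.mono_left nhdsWithin_le_nhds
    · filter_upwards [self_mem_nhdsWithin] with δ hδ
      exact div_pos (mem_Ioi.1 hδ) hk
  have h1 := (h.comp hdiv).neg
  rw [neg_zero] at h1
  refine h1.congr' (Eventually.of_forall fun δ => ?_)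
  show -(φ (k * (δ / k)) - φ (δ / k)) = φ (δ / k) - φ δ
  rw [mul_div_cancel₀ _ hk.ne']
  ring

/-- **Lags pass along asymptotically merging functions**: if `g (δ / k) − g δ → 0` and
`f − g → 0` as `δ → 0⁺` (`k > 0`), then `f (δ / k) − f δ → 0`. [folklore] -/
theorem tendsto_lag_of_tendsto_sub {f g : ℝ → ℝ} {k : ℝ} (hk : 0 < k)
    (hg : Tendsto (fun δ : ℝ => g (δ / k) - g δ) (𝓝[>] (0 : ℝ)) (𝓝 0))
    (hfg : Tendsto (fun δ : ℝ => f δ - g δ) (𝓝[>] (0 : ℝ)) (𝓝 0)) :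
    Tendsto (fun δ : ℝ => f (δ / k) - f δ) (𝓝[>] (0 : ℝ)) (𝓝 0) := by
  have hdiv : Tendsto (fun δ : ℝ => δ / k) (𝓝[>] (0 : ℝ)) (𝓝[>] (0 : ℝ)) := by
    refine tendsto_nhdsWithin_of_tendsto_nhds_of_eventually_within _ ?_ ?_
    · have h0 : Tendsto (fun δ : ℝ => δ / k) (𝓝 0) (𝓝 (0 / k)) := tendsto_id.div_const k
      rw [zero_div] at h0
      exact h0.mono_left nhdsWithin_le_nhds
    · filter_upwards [self_mem_nhdsWithin] with δ hδ
      exact div_pos (mem_Ioi.1 hδ) hk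
  have h1 : Tendsto (fun δ : ℝ => f (δ / k) - g (δ / k)) (𝓝[>] (0 : ℝ)) (𝓝 0) :=
    hfg.comp hdiv
  have h2 := (h1.add hg).sub hfg
  rw [add_zero, sub_zero] at h2
  refine h2.congr' (Eventually.of_forall fun δ => ?_)
  show f (δ / k) - g (δ / k) + (g (δ / k) - g δ) - (f δ - g δ) = f (δ / k) - f δ
  ring

/-- Under a merging `f − g → 0`, the two functions have the SAME lags: `f (δ/k) − f δ → 0` iff
`g (δ/k) − g δ → 0` (`k > 0`). [folklore] -/
theorem tendsto_lag_iff_of_tendsto_sub {f g : ℝ → ℝ} {k : ℝ} (hk : 0 < k)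
    (hfg : Tendsto (fun δ : ℝ => f δ - g δ) (𝓝[>] (0 : ℝ)) (𝓝 0)) :
    Tendsto (fun δ : ℝ => f (δ / k) - f δ) (𝓝[>] (0 : ℝ)) (𝓝 0) ↔
      Tendsto (fun δ : ℝ => g (δ / k) - g δ) (𝓝[>] (0 : ℝ)) (𝓝 0) := by
  refine ⟨fun hf => tendsto_lag_of_tendsto_sub hk hf ?_, fun hg => tendsto_lag_of_tendsto_sub hk hg hfg⟩
  have h := hfg.neg
  rw [neg_zero] at h
  exact h.congr' (Eventually.of_forall fun δ => by show -(f δ - g δ) = g δ - f δ; ring)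

/-! ### The DKKMO crossing probability of a rectangle IS the Schramm–Smirnov one of its quad -/

/-- **`quadCrossingProb δ R = μ_δ(⊞_Q)` exactly** (`δ > 0`), for any quad `Q ∈ 𝒬_ℂ` with
carrier the closed quad of `R` and sides `0`, `2` the arcs `0`, `2` of `R` (square models,
`exists_isSquareModel`): DKKMO's path-crossing event of `R` is the event that `Q` has a
Schramm–Smirnov crossing inside the drawn open edges (`quadCrossing_eq_setOf_exists_isCrossing`),
which is `{ω : Q ∈ ω_δ}` (`mem_z2QuadConfig_iff_exists_isCrossing`, the raw crossed set is closed),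
and `μ_δ = z2QuadLaw univ δ` is the push-forward of `P_{1/2}` under the measurable `ω ↦ ω_δ`
(`z2QuadLaw_apply`). [cite: SchrammSmirnov2011, §1.3] -/
theorem quadCrossingProb_eq_measureReal_z2QuadLaw {R : ConformalRectangle}
    {Q : Quad (univ : Set ℂ)} (hc : Q.carrier = closure R.carrier) (h0 : Q.side 0 = R.arc 0)
    (h2 : Q.side 2 = R.arc 2) {δ : ℝ} (hδ : 0 < δ) :
    quadCrossingProb δ R =
      (z2QuadLaw (univ : Set ℂ) δ : Measure (QuadCrossingSpace (univ : Set ℂ))).real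
        (QuadConfig.crossedEvent Q) := by
  have hev : quadCrossing R δ = z2QuadConfig (univ : Set ℂ) δ ⁻¹' QuadConfig.crossedEvent Q := by
    rw [quadCrossing_eq_setOf_exists_isCrossing hc h0 h2 hδ]
    ext ω
    rw [mem_setOf_eq, mem_preimage, QuadConfig.mem_crossedEvent,
      mem_z2QuadConfig_iff_exists_isCrossing hδ]
  rw [quadCrossingProb, hev, measureReal_def, measureReal_def,
    z2QuadLaw_apply isOpen_univ hδ (QuadConfig.measurableSet_crossedEvent Q)]

/-! ### `ScaleInvariantLimits` ⇒ vanishing lags of the Schramm–Smirnov / DKKMO crossing probabilities -/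

/-- **`X` ⇒ lag merging of `μ_δ(⊞_Q)` for one quad, mesh `meshPoint δ`.**  For every quad
`Q ∈ 𝒬_ℂ` and `k > 1`, `μ_{kδ}(⊞_Q) − μ_δ(⊞_Q) → 0` as `δ → 0⁺` (`μ_δ = z2QuadLaw univ δ`):
`stub_lags_of_scaleInvariantLimits` (compactness of `ℋ_ℂ`, `S_k μ = μ`, Cor. 5.2) with Lemma 5.1
discharged (`SchrammSmirnov2011_lemma_5_1_holds`), at the one-member family `i ↦ Q`, then the mesh
renormalisation `squareCrossingLaw univ η = z2QuadLaw univ (η√2)` undone by `tendsto_lag_of_rescale`.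
[cite: SchrammSmirnov2011, Lemma 5.1 and Cor. 5.2] -/
theorem tendsto_lag_z2QuadLaw_of_scaleInvariantLimits (hX : ScaleInvariantLimits)
    (Q : Quad (univ : Set ℂ)) {k : ℝ} (hk : 1 < k) :
    Tendsto (fun δ : ℝ =>
      (z2QuadLaw (univ : Set ℂ) (k * δ) : Measure (QuadCrossingSpace (univ : Set ℂ))).real
          (QuadConfig.crossedEvent Q) -
        (z2QuadLaw (univ : Set ℂ) δ : Measure (QuadCrossingSpace (univ : Set ℂ))).real
          (QuadConfig.crossedEvent Q)) (𝓝[>] (0 : ℝ)) (𝓝 0) := by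
  have hev : {S : QuadConfig (univ : Set ℂ) | ∀ _i : Fin 1, Q ∈ S} = QuadConfig.crossedEvent Q := by
    ext S
    simp only [mem_setOf_eq, QuadConfig.mem_crossedEvent, forall_const]
  have h := stub_lags_of_scaleInvariantLimits SchrammSmirnov2011_lemma_5_1_holds hX k hk 1
    (fun _ => Q)
  simp only [hev, squareCrossingLaw_eq_z2QuadLaw] at h
  exact tendsto_lag_of_rescale (φ := fun t : ℝ =>
    (z2QuadLaw (univ : Set ℂ) t : Measure (QuadCrossingSpace (univ : Set ℂ))).real
      (QuadConfig.crossedEvent Q)) (Real.sqrt_pos.mpr (by norm_num)) h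

/-- **`X` ⇒ S1 for the DKKMO / Schramm–Smirnov rendering of the crossing probability**, at every
lag: for every conformal rectangle `R` and every `k > 1`,
`quadCrossingProb (δ/k) R − quadCrossingProb δ R → 0` as `δ → 0⁺`.  (Square model `Q` of `R`,
`quadCrossingProb δ R = μ_δ(⊞_Q)` for `δ > 0`, the previous lemma, lag read downwards.)
[cite: SchrammSmirnov2011, §1.3, Lemma 5.1, Cor. 5.2] -/
theorem quadCrossingProb_lag_of_scaleInvariantLimits (hX : ScaleInvariantLimits)
    (R : ConformalRectangle) {k : ℝ} (hk : 1 < k) :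
    Tendsto (fun δ : ℝ => quadCrossingProb (δ / k) R - quadCrossingProb δ R)
      (𝓝[>] (0 : ℝ)) (𝓝 0) := by
  have hk0 : 0 < k := lt_trans one_pos hk
  obtain ⟨Φ, hΦ⟩ := exists_isSquareModel R
  set Q : Quad (univ : Set ℂ) := squareModelQuad Φ with hQ
  have hc : Q.carrier = closure R.carrier := hΦ.carrier_squareModelQuad
  have h0 : Q.side 0 = R.arc 0 := hΦ.side_zero_squareModelQuad
  have h2 : Q.side 2 = R.arc 2 := hΦ.side_two_squareModelQuad
  -- the lag read upwards for `μ_δ(⊞_Q)`, transported to `quadCrossingProb` on `(0, ∞)`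
  have hup : Tendsto (fun η : ℝ => quadCrossingProb (k * η) R - quadCrossingProb η R)
      (𝓝[>] (0 : ℝ)) (𝓝 0) := by
    refine (tendsto_lag_z2QuadLaw_of_scaleInvariantLimits hX Q hk).congr' ?_
    filter_upwards [self_mem_nhdsWithin] with η hη
    rw [quadCrossingProb_eq_measureReal_z2QuadLaw hc h0 h2 (mul_pos hk0 (mem_Ioi.1 hη)),
      quadCrossingProb_eq_measureReal_z2QuadLaw hc h0 h2 (mem_Ioi.1 hη)]
  exact tendsto_lag_div_of_tendsto_lag_mul (φ := fun t => quadCrossingProb t R) hk0 hup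

/-- **`X` ⇒ the two lattice lags of S1 for the DKKMO rendering**, for every conformal rectangle:
`quadCrossingProb (δ/2) R − quadCrossingProb δ R → 0` and
`quadCrossingProb (δ/3) R − quadCrossingProb δ R → 0` as `δ → 0⁺`.
[cite: SchrammSmirnov2011, §1.3, Lemma 5.1, Cor. 5.2] -/
theorem quadCrossingProb_latticeTwoLags_of_scaleInvariantLimits (hX : ScaleInvariantLimits)
    (R : ConformalRectangle) :
    Tendsto (fun δ : ℝ => quadCrossingProb (δ / 2) R - quadCrossingProb δ R)
        (𝓝[>] (0 : ℝ)) (𝓝 0) ∧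
      Tendsto (fun δ : ℝ => quadCrossingProb (δ / 3) R - quadCrossingProb δ R)
        (𝓝[>] (0 : ℝ)) (𝓝 0) :=
  ⟨quadCrossingProb_lag_of_scaleInvariantLimits hX R one_lt_two,
    quadCrossingProb_lag_of_scaleInvariantLimits hX R (by norm_num)⟩

/-! ### The dictionary hypothesis and stub S1 -/

/-- **Under the rectangle ↔ quad dictionary the two renderings have the same lags.**  If
`bondDomainCrossingProb R δ − quadCrossingProb δ R → 0` (`δ → 0⁺`), then for every `k > 0` the
G02 crossing probability of `R` has vanishing lag `k` iff the DKKMO one has. [folklore] -/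
theorem latticeLag_iff_of_dictionary (R : ConformalRectangle)
    (hdict : Tendsto (fun δ : ℝ => bondDomainCrossingProb R δ - quadCrossingProb δ R)
      (𝓝[>] (0 : ℝ)) (𝓝 0)) {k : ℝ} (hk : 0 < k) :
    Tendsto (fun δ : ℝ => bondDomainCrossingProb R (δ / k) - bondDomainCrossingProb R δ)
        (𝓝[>] (0 : ℝ)) (𝓝 0) ↔
      Tendsto (fun δ : ℝ => quadCrossingProb (δ / k) R - quadCrossingProb δ R)
        (𝓝[>] (0 : ℝ)) (𝓝 0) :=
  tendsto_lag_iff_of_tendsto_sub (f := fun t => bondDomainCrossingProb R t)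
    (g := fun t => quadCrossingProb t R) hk hdict

/-- **S1 for one rectangle from `X` and the dictionary for that rectangle.**  If every
subsequential quad-crossing limit of bond-`ℤ²` is dilation invariant (`ScaleInvariantLimits`,
stmt-CriticalPhenomena-10265) and the G02 and DKKMO crossing probabilities of the conformal
rectangle `R` merge as `δ → 0⁺`, then `P_{δ/2}(R) − P_δ(R) → 0` and `P_{δ/3}(R) − P_δ(R) → 0`.
[cite: SchrammSmirnov2011, §1.3, Lemma 5.1, Cor. 5.2] -/
theorem latticeTwoLags_of_scaleInvariantLimits_of_dictionary (hX : ScaleInvariantLimits)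
    (R : ConformalRectangle)
    (hdict : Tendsto (fun δ : ℝ => bondDomainCrossingProb R δ - quadCrossingProb δ R)
      (𝓝[>] (0 : ℝ)) (𝓝 0)) :
    Tendsto (fun δ : ℝ => bondDomainCrossingProb R (δ / 2) - bondDomainCrossingProb R δ)
        (nhdsWithin (0 : ℝ) (Set.Ioi 0)) (𝓝 0) ∧
      Tendsto (fun δ : ℝ => bondDomainCrossingProb R (δ / 3) - bondDomainCrossingProb R δ)
        (nhdsWithin (0 : ℝ) (Set.Ioi 0)) (𝓝 0) := by
  obtain ⟨h2, h3⟩ := quadCrossingProb_latticeTwoLags_of_scaleInvariantLimits hX R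
  exact ⟨(latticeLag_iff_of_dictionary R hdict two_pos).2 h2,
    (latticeLag_iff_of_dictionary R hdict three_pos).2 h3⟩

/-- **`stub_latticeTwoLags_of_scaleInvariantLimits`** (registered on stmt-CriticalPhenomena-5767):
the CardySelfRefinement target `ScaleInvariantLimits` (stmt-CriticalPhenomena-10265, by name) and
the rectangle ↔ quad dictionary (`bondDomainCrossingProb R δ − quadCrossingProb δ R → 0` for every
conformal rectangle, VERBATIM — the open boundary-RSW transfer flagged in
`QuadCrossingSpaceZ2.lean` / `QuadCrossingRotationInvariance.lean`) imply stub S1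
`stub_latticeTwoLags` (verbatim as conclusion). [cite: SchrammSmirnov2011, §1.3, Lemma 5.1, Cor. 5.2] -/
theorem stub_latticeTwoLags_of_scaleInvariantLimits :
    Summit.CriticalPhenomena.CardyFormulaZ2.Theses.CardySelfRefinement.ScaleInvariantLimits →
    (∀ R : Literature.Probability.RandomPlanarGeometry.ConformalRectangle,
      Filter.Tendsto (fun δ : ℝ => Literature.Probability.Percolation.bondDomainCrossingProb R δ -
        Literature.Probability.Percolation.quadCrossingProb δ R)
        (nhdsWithin (0 : ℝ) (Set.Ioi 0)) (nhds 0)) →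
    ∀ R : Literature.Probability.RandomPlanarGeometry.ConformalRectangle,
      Filter.Tendsto (fun δ : ℝ => Literature.Probability.Percolation.bondDomainCrossingProb R (δ / 2) -
        Literature.Probability.Percolation.bondDomainCrossingProb R δ)
        (nhdsWithin (0 : ℝ) (Set.Ioi 0)) (nhds 0) ∧
      Filter.Tendsto (fun δ : ℝ => Literature.Probability.Percolation.bondDomainCrossingProb R (δ / 3) -
        Literature.Probability.Percolation.bondDomainCrossingProb R δ)
        (nhdsWithin (0 : ℝ) (Set.Ioi 0)) (nhds 0) :=
  fun hX hdict R => latticeTwoLags_of_scaleInvariantLimits_of_dictionary hX R (hdict R)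

/-- **The engine form.**  The two open engine cruxes of route CardySelfRefinement,
`TrivialSectorRate` (stmt-CriticalPhenomena-10266) and `GradientComparability`
(stmt-CriticalPhenomena-10269), give `ScaleInvariantLimits` through the PROVED items
`CriticalPathRSW_proof`, `russoDrift_proof` and `scaleInvariantLimits_of_engine` (Beffara's
self-refinement interpolation; `ExactEndpoints`, `LagsToInvariance`, `TwoLagsAllLags` inside); with
the dictionary they imply stub S1. [cite: Beffara2008Universal, §5] -/
theorem latticeTwoLags_of_engine_of_dictionary (hTSR : TrivialSectorRate)
    (hGC : GradientComparability)
    (hdict : ∀ R : ConformalRectangle,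
      Tendsto (fun δ : ℝ => bondDomainCrossingProb R δ - quadCrossingProb δ R)
        (𝓝[>] (0 : ℝ)) (𝓝 0)) :
    ∀ R : ConformalRectangle,
      Tendsto (fun δ : ℝ => bondDomainCrossingProb R (δ / 2) - bondDomainCrossingProb R δ)
          (nhdsWithin (0 : ℝ) (Set.Ioi 0)) (𝓝 0) ∧
        Tendsto (fun δ : ℝ => bondDomainCrossingProb R (δ / 3) - bondDomainCrossingProb R δ)
          (nhdsWithin (0 : ℝ) (Set.Ioi 0)) (𝓝 0) :=
  stub_latticeTwoLags_of_scaleInvariantLimits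
    (scaleInvariantLimits_of_engine hTSR CriticalPathRSW_proof hGC russoDrift_proof) hdict

end Summit.CriticalPhenomena.CardyFormulaZ2.Theorems.CardyShadowIsolated.LatticeTwoLags

end
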